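import Literature.AlgebraicGeometry.Motives.HodgeStructureHodgeVectorBlockHodgeNumbers
import Literature.AlgebraicGeometry.Motives.HodgeStructureHodgeVectorBlockCanonical
import HarnessLib

/-!
# HODGE VECTORS ARE THE MORPHISMS FROM THE TATE STRUCTURE: `Hom_HS(ℚ(−m), V) ≅ V₀ = V ∩ V^{m,m}` (evaluation at `1`),
# `Hom_HS(W_{(m,m)}, V) ≅ Hom_ℚ(W, V₀)`, `dim Hom_HS(ℚ(−m)^r, V) = r · dim V₀`; and, through a polarization `ψ`, the morphisms TO the
# Tate structure: `Hom_HS(V, ℚ(−m)) ≅ V₀`, `φ = ψ(v, ·)` for a unique Hodge vector `v`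
# (Deligne, Hodge II 2.1.13–2.1.14; Arapura §1 «`Hodge(H) := Hom_MHS(ℚ(0), H)`»; Deligne, LNM 900, I §3 («`ψ : V ⊗ V → ℚ(−n)` is a morphism»);
# Green–Griffiths–Kerr §I.A p. 33)

[topic AlgebraicGeometry/Motives]

Layer `Literature/AlgebraicGeometry/Motives`, lane `lit-hodgefound` (Track 2 foundations library; seat `lit-hodgefound-p02`, gen 41,
row g41-#7). THEOREMS ONLY: no definition, no named fact (D-0026 net debt `0`), no instance, no notation. Sequel BY NAME of g41-#6
`Motives/HodgeStructureHodgeVectorBlockHodgeNumbers` (`exists_hom_toLinearMap_eq_of_hodgeClasses_eq_top`: a linear map OUT of a pure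
`(m,m)` structure INTO Hodge vectors is a morphism; `hodgeClasses_pure_eq_top`) and g41-#4 `Motives/HodgeStructureHodgeVectorBlockCanonical`
(`Hom.range_le_hodgeClasses_of_hodgeClasses_eq_top`: a morphism out of a pure `(m,m)` structure lands in Hodge vectors); from the tree:
`HodgeStructure.pure`, `tate`, `cast` (`Motives/HodgeStructure`), the `ℚ`-module `Hom H₁ H₂` (`Motives/HodgeStructureQuotient`),
`Polarization.toDualEquiv` (`θ = ψ♭ : V ≃ V^∨`, `Motives/MumfordTateInvariantsDualForm`), **`Polarization.mem_F_iff`** (`Fᵖ` is the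
`ψ_ℂ`-orthogonal of `F^{n+1-p}`) and `Polarization.form_baseChange_swap` (`Motives/HodgeStructureK3TypeAdjointProofs`). The tree's
`Motives/MixedHodgeStructureHodgeClasses` uses «`Hodge(H) := Hom_MHS(ℚ(0), H)`» (Arapura) as the informal dictionary for `hodgeClasses`;
this file PROVES the dictionary in the pure case as explicit `ℚ`-linear equivalences.

## The sources, verbatim

* P. Deligne, *Théorie de Hodge II* [DeligneHodgeII1971]: 2.1.13 (the Tate structure `ℤ(1)`, of type `(−1,−1)`; `ℤ(n) = ℤ(1)^{⊗n}`),
  2.1.14 (morphisms and Tate twists), 2.1.15 (a polarization is a morphism `H ⊗ H → ℚ(−n)`).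
* D. Arapura, *Hodge cycles and the Leray filtration* [Arapura2022], §1 p. 3: «Given a mixed Hodge structure `H`, set
  `Hodge(H) := Hom_MHS(ℚ(0), H)`.»
* P. Deligne, *Hodge cycles on abelian varieties*, LNM 900 [Deligne1982HodgeCycles], I §3 (proof of Prop. 3.6, held p0039): «Recall that `ψ`
  is a morphism `ψ : V ⊗ V → ℚ(−n)` of Hodge structures».
* M. Green, P. Griffiths, M. Kerr, *Mumford–Tate Groups and Domains* [GreenGriffithsKerr2012], §I.A p. 33 («`ℚ(p)` … pure Hodge type»;
  Hodge classes `Hg(V) = V ∩ V^{p,p}`, §I.B p. 36).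

## The mechanism

A morphism `φ : W_{(m,m)} → V` out of a structure purely of type `(m,m)` maps `W = Hdgᵐ(W)` into `Hdgᵐ(V) = V₀` (morphisms preserve Hodge
classes), and conversely every `ℚ`-linear `W → V₀` is a morphism (g41-#6): `Hom_HS(W_{(m,m)}, V) = Hom_ℚ(W, V₀)`, and for `W = ℚ` evaluation
at `1` gives `Hom_HS(ℚ(−m), V) ≅ V₀` (§1, §2). Dually, for `v ∈ V₀` the functional `ψ(v, ·)` kills `F^{m+1} ⊆ F^{n+1-m}` (first Hodge–Riemann
relation against `1 ⊗ v ∈ Fᵐ`), so it is a morphism `V → ℚ(−m)`; conversely if `ψ(v, ·)` is a morphism then `ψ_ℂ(1 ⊗ v, F^{m+1}) = 0`, i.e.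
`1 ⊗ v ∈ (F^{n+1-m})^{⊥ψ} = Fᵐ` (`Polarization.mem_F_iff`), so `v ∈ V₀`; and every functional is `ψ(v, ·)` for a unique `v`
(non-degeneracy): `Hom_HS(V, ℚ(−m)) ≅ V₀` (§3).

## What is proved (`n = 2m`; `V₀ = H.hodgeClasses m`)

* §1 (out of a pure `(m,m)` structure `H₁`, `Hdgᵐ(H₁) = ⊤`) **`exists_hom_toLinearMap_eq_iff_range_le_hodgeClasses`** (`f` underlies a
  morphism `⟺ im f ⊆ V₀`), `Hom.apply_mem_hodgeClasses_of_hodgeClasses_eq_top`, **`exists_linearEquiv_hom_linearMap_hodgeClasses`**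
  (`Hom_HS(H₁, H) ≃ₗ Hom_ℚ(V₁, V₀)`), `finrank_hom_eq_mul_finrank_hodgeClasses` (`dim Hom_HS(H₁, H) = dim V₁ · dim V₀`).
* §2 (the Tate structure) `Hom.eq_of_apply_one_eq`, **`mem_hodgeClasses_iff_exists_homFromPure`** (`v ∈ V₀ ⟺ v = φ(1)` for a morphism
  `φ : ℚ(−m) → V`), **`exists_linearEquiv_homFromPure_hodgeClasses`** (`Hom_HS(ℚ(−m), V) ≃ₗ V₀`, `φ ↦ φ(1)`),
  `finrank_homFromPure_eq_finrank_hodgeClasses`; the same with the tree's `tate (−m)` transported to weight `n`: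
  `hodgeClasses_tate_cast_eq_top`, `mem_hodgeClasses_iff_exists_homFromTate`, `exists_linearEquiv_homFromTate_hodgeClasses`.
* §3 (into the Tate structure, `ψ` a polarization) **`Polarization.exists_homToPure_toLinearMap_eq_form`** (`v ∈ V₀ ⟹ ψ(v,·) : V → ℚ(−m)` is
  a morphism), **`Polarization.mem_hodgeClasses_of_homToPure_toLinearMap_eq_form`** (the converse, via `mem_F_iff`),
  `Polarization.mem_hodgeClasses_iff_exists_homToPure_eq_form`, **`Polarization.exists_mem_hodgeClasses_homToPure_eq_form`** (every
  morphism `V → ℚ(−m)` is `ψ(v,·)` for a Hodge vector `v`), `Polarization.eq_of_form_eq_form` (uniqueness),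
  **`Polarization.exists_linearEquiv_homToPure_hodgeClasses`** (`Hom_HS(V, ℚ(−m)) ≃ₗ V₀`), `Polarization.finrank_homToPure_eq_finrank_hodgeClasses`,
  `Polarization.finrank_homToPure_eq_finrank_homFromPure` (`dim Hom_HS(V, ℚ(−m)) = dim Hom_HS(ℚ(−m), V)`), `finrank_homToPure_eq_finrank_homFromPure_of_isPolarizable`.

## References

* [DeligneHodgeII1971] P. Deligne, *Théorie de Hodge II*, Publ. Math. IHÉS 40 (1971): 2.1.13–2.1.15.
* [Arapura2022] D. Arapura, *Hodge cycles and the Leray filtration*, Pacific J. Math. 319 (2022) 233–258: §1 p. 3.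
* [Deligne1982HodgeCycles] P. Deligne, *Hodge cycles on abelian varieties*, in LNM 900 (1982): I §3, proof of Prop. 3.6.
* [GreenGriffithsKerr2012] M. Green, P. Griffiths, M. Kerr, *Mumford–Tate Groups and Domains*, Ann. of Math. Stud. 183 (2012): §I.A p. 33, §I.B p. 36.
-/

noncomputable section

open Module
open scoped TensorProduct

namespace Literature.AlgebraicGeometry.Motives

namespace HodgeStructure

universe u v

variable {V : Type u} [AddCommGroup V] [Module ℚ V] [Module.Finite ℚ V] {n : ℤ} {H : HodgeStructure V n}
variable {V' : Type v} [AddCommGroup V'] [Module ℚ V']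

/-! ## §1 Morphisms out of a pure `(m,m)` structure are the linear maps into `V₀` -/

omit [Module.Finite ℚ V] in
/-- **A `ℚ`-linear map out of a pure `(m,m)` structure underlies a morphism iff it lands in the Hodge vectors** (`→`: morphisms
preserve Hodge classes, g41-#4; `←`: g41-#6). [cite: DeligneHodgeII1971, 2.1.13–2.1.14] [cite: GreenGriffithsKerr2012, §I.A p. 33] -/
theorem exists_hom_toLinearMap_eq_iff_range_le_hodgeClasses {H₁ : HodgeStructure V' n} {H₂ : HodgeStructure V n} {m : ℤ}
    (hm : m + m = n) (h₁ : H₁.hodgeClasses m = ⊤) (f : V' →ₗ[ℚ] V) :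
    (∃ φ : Hom H₁ H₂, φ.toLinearMap = f) ↔ LinearMap.range f ≤ H₂.hodgeClasses m := by
  refine ⟨?_, exists_hom_toLinearMap_eq_of_hodgeClasses_eq_top hm h₁ f⟩
  rintro ⟨φ, rfl⟩
  exact φ.range_le_hodgeClasses_of_hodgeClasses_eq_top h₁

omit [Module.Finite ℚ V] in
/-- A morphism out of a pure `(m,m)` structure takes Hodge-vector values. [cite: GreenGriffithsKerr2012, §I.B p. 36] -/
theorem Hom.apply_mem_hodgeClasses_of_hodgeClasses_eq_top {H₁ : HodgeStructure V' n} {H₂ : HodgeStructure V n} (φ : Hom H₁ H₂)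
    {m : ℤ} (h₁ : H₁.hodgeClasses m = ⊤) (v : V') : φ.toLinearMap v ∈ H₂.hodgeClasses m :=
  φ.range_le_hodgeClasses_of_hodgeClasses_eq_top h₁ ⟨v, rfl⟩

omit [Module.Finite ℚ V] in
/-- **`Hom_HS(H₁, H) ≅ Hom_ℚ(V₁, V₀)` for `H₁` purely of type `(m,m)`**: co-restriction to `V₀ = Hdgᵐ(H)` is a `ℚ`-linear
equivalence. [cite: DeligneHodgeII1971, 2.1.13–2.1.14] [cite: Arapura2022, §1 p. 3] -/
theorem exists_linearEquiv_hom_linearMap_hodgeClasses {H₁ : HodgeStructure V' n} {H₂ : HodgeStructure V n} {m : ℤ}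
    (hm : m + m = n) (h₁ : H₁.hodgeClasses m = ⊤) :
    ∃ e : Hom H₁ H₂ ≃ₗ[ℚ] (V' →ₗ[ℚ] H₂.hodgeClasses m), ∀ φ v, ((e φ v : H₂.hodgeClasses m) : V) = φ.toLinearMap v := by
  have hcod : ∀ φ : Hom H₁ H₂, ∀ v, φ.toLinearMap v ∈ H₂.hodgeClasses m := fun φ =>
    φ.apply_mem_hodgeClasses_of_hodgeClasses_eq_top h₁
  have hlift : ∀ g : V' →ₗ[ℚ] H₂.hodgeClasses m, ∃ φ : Hom H₁ H₂, φ.toLinearMap = (H₂.hodgeClasses m).subtype ∘ₗ g :=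
    fun g => exists_hom_toLinearMap_eq_of_hodgeClasses_eq_top hm h₁ _
      ((LinearMap.range_comp_le_range g (H₂.hodgeClasses m).subtype).trans_eq (Submodule.range_subtype _))
  choose lift hlift using hlift
  refine ⟨{ toFun := fun φ => LinearMap.codRestrict (H₂.hodgeClasses m) φ.toLinearMap (hcod φ)
            map_add' := fun φ φ' => LinearMap.ext fun v => Subtype.ext (by simp)
            map_smul' := fun c φ => LinearMap.ext fun v => Subtype.ext (by simp)
            invFun := lift
            left_inv := fun φ => Hom.ext ((hlift _).trans (LinearMap.subtype_comp_codRestrict _ _ _))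
            right_inv := fun g => LinearMap.ext fun v => Subtype.ext ?_ }, fun φ v => rfl⟩
  change ((LinearMap.codRestrict (H₂.hodgeClasses m) (lift g).toLinearMap (hcod (lift g)) v : H₂.hodgeClasses m) : V) = g v
  rw [LinearMap.codRestrict_apply, hlift g, LinearMap.comp_apply, Submodule.subtype_apply]

omit [Module.Finite ℚ V] in
/-- **`dim_ℚ Hom_HS(H₁, H) = dim V₁ · dim V₀`** for `H₁` purely of type `(m,m)` (e.g. `dim Hom_HS(ℚ(−m)^r, V) = r · dim V₀`).
[cite: DeligneHodgeII1971, 2.1.13–2.1.14] -/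
theorem finrank_hom_eq_mul_finrank_hodgeClasses [Module.Finite ℚ V'] {H₁ : HodgeStructure V' n} {H₂ : HodgeStructure V n} {m : ℤ}
    (hm : m + m = n) (h₁ : H₁.hodgeClasses m = ⊤) : finrank ℚ (Hom H₁ H₂) = finrank ℚ V' * finrank ℚ (H₂.hodgeClasses m) := by
  obtain ⟨e, -⟩ := exists_linearEquiv_hom_linearMap_hodgeClasses (H₂ := H₂) hm h₁
  rw [e.finrank_eq, Module.finrank_linearMap ℚ ℚ V' _]

/-! ## §2 The Tate structure: `Hom_HS(ℚ(−m), V) ≅ V₀` by evaluation at `1` -/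

omit [Module.Finite ℚ V] in
/-- Two morphisms out of a Hodge structure on the line `ℚ` agreeing at `1` are equal. [cite: DeligneHodgeII1971, 2.1.14] -/
theorem Hom.eq_of_apply_one_eq {H₁ : HodgeStructure ℚ n} {H₂ : HodgeStructure V n} {φ ψ : Hom H₁ H₂}
    (h : φ.toLinearMap 1 = ψ.toLinearMap 1) : φ = ψ :=
  Hom.ext (LinearMap.ext_ring h)

omit [Module.Finite ℚ V] in
/-- **A Hodge vector of type `(m,m)` is the same as a morphism `ℚ(−m) → V`**: `v ∈ V₀ ⟺ v = φ(1)` for a morphism `φ` from the structure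
purely of type `(m,m)` on `ℚ` (the tree's `pure ℚ m n`, i.e. `ℚ(−m)`). [cite: Arapura2022, §1 p. 3] [cite: DeligneHodgeII1971, 2.1.13–2.1.14] -/
theorem mem_hodgeClasses_iff_exists_homFromPure {m : ℤ} (hn : n = 2 * m) (v : V) :
    v ∈ H.hodgeClasses m ↔ ∃ φ : Hom (pure ℚ m n hn) H, φ.toLinearMap 1 = v := by
  constructor
  · intro hv
    obtain ⟨φ, hφ⟩ := exists_hom_toLinearMap_eq_of_hodgeClasses_eq_top (H₂ := H) (show m + m = n by omega)
      (hodgeClasses_pure_eq_top ℚ m hn) (LinearMap.toSpanSingleton ℚ V v) (by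
        rintro _ ⟨c, rfl⟩
        rw [LinearMap.toSpanSingleton_apply]
        exact Submodule.smul_mem _ c hv)
    exact ⟨φ, by rw [hφ, LinearMap.toSpanSingleton_apply, one_smul]⟩
  · rintro ⟨φ, rfl⟩
    exact φ.apply_mem_hodgeClasses_of_hodgeClasses_eq_top (hodgeClasses_pure_eq_top ℚ m hn) 1

omit [Module.Finite ℚ V] in
/-- **`Hom_HS(ℚ(−m), V) ≅ V₀`**, `φ ↦ φ(1)`. [cite: Arapura2022, §1 p. 3 («`Hodge(H) := Hom_MHS(ℚ(0), H)`»)] [cite: DeligneHodgeII1971, 2.1.13–2.1.14] -/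
theorem exists_linearEquiv_homFromPure_hodgeClasses {m : ℤ} (hn : n = 2 * m) :
    ∃ e : Hom (pure ℚ m n hn) H ≃ₗ[ℚ] H.hodgeClasses m, ∀ φ, (e φ : V) = φ.toLinearMap 1 := by
  obtain ⟨e, he⟩ := exists_linearEquiv_hom_linearMap_hodgeClasses (H₁ := pure ℚ m n hn) (H₂ := H) (show m + m = n by omega)
    (hodgeClasses_pure_eq_top ℚ m hn)
  exact ⟨e.trans (LinearMap.ringLmapEquivSelf ℚ ℚ _), fun φ => by rw [LinearEquiv.trans_apply, LinearMap.ringLmapEquivSelf_apply, he]⟩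

omit [Module.Finite ℚ V] in
/-- `dim_ℚ Hom_HS(ℚ(−m), V) = dim V₀`. [cite: Arapura2022, §1 p. 3] [cite: DeligneHodgeII1971, 2.1.13–2.1.14] -/
theorem finrank_homFromPure_eq_finrank_hodgeClasses {m : ℤ} (hn : n = 2 * m) :
    finrank ℚ (Hom (pure ℚ m n hn) H) = finrank ℚ (H.hodgeClasses m) := by
  obtain ⟨e, -⟩ := exists_linearEquiv_homFromPure_hodgeClasses (H := H) hn
  exact e.finrank_eq

/-- The tree's Tate structure `tate (−m) = ℚ(−m)`, transported to weight `n = −2·(−m)`, consists of Hodge vectors of type `(m,m)`.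
[cite: DeligneHodgeII1971, 2.1.13] -/
theorem hodgeClasses_tate_cast_eq_top (m : ℤ) (h : -2 * -m = n) : ((tate (-m)).cast h).hodgeClasses m = ⊤ :=
  eq_top_iff.2 fun q _ => by
    rw [mem_hodgeClasses_iff, cast_F, tate_F, pureFiltration_of_le (neg_neg m).symm.le]
    exact Submodule.mem_top

omit [Module.Finite ℚ V] in
/-- `v ∈ V₀ ⟺ v = φ(1)` for a morphism `φ : ℚ(−m) → V`, with `ℚ(−m)` the tree's `tate (−m)` transported to weight `n`.
[cite: Arapura2022, §1 p. 3] [cite: DeligneHodgeII1971, 2.1.13–2.1.14] -/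
theorem mem_hodgeClasses_iff_exists_homFromTate {m : ℤ} (h : -2 * -m = n) (v : V) :
    v ∈ H.hodgeClasses m ↔ ∃ φ : Hom ((tate (-m)).cast h) H, φ.toLinearMap 1 = v := by
  constructor
  · intro hv
    obtain ⟨φ, hφ⟩ := exists_hom_toLinearMap_eq_of_hodgeClasses_eq_top (H₂ := H) (show m + m = n by omega)
      (hodgeClasses_tate_cast_eq_top m h) (LinearMap.toSpanSingleton ℚ V v) (by
        rintro _ ⟨c, rfl⟩
        rw [LinearMap.toSpanSingleton_apply]
        exact Submodule.smul_mem _ c hv)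
    exact ⟨φ, by rw [hφ, LinearMap.toSpanSingleton_apply, one_smul]⟩
  · rintro ⟨φ, rfl⟩
    exact φ.apply_mem_hodgeClasses_of_hodgeClasses_eq_top (hodgeClasses_tate_cast_eq_top m h) 1

omit [Module.Finite ℚ V] in
/-- **`Hom_HS(ℚ(−m), V) ≅ V₀`** with the tree's `tate (−m)` transported to weight `n`. [cite: Arapura2022, §1 p. 3] [cite: DeligneHodgeII1971, 2.1.13–2.1.14] -/
theorem exists_linearEquiv_homFromTate_hodgeClasses {m : ℤ} (h : -2 * -m = n) :
    ∃ e : Hom ((tate (-m)).cast h) H ≃ₗ[ℚ] H.hodgeClasses m, ∀ φ, (e φ : V) = φ.toLinearMap 1 := by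
  obtain ⟨e, he⟩ := exists_linearEquiv_hom_linearMap_hodgeClasses (H₁ := (tate (-m)).cast h) (H₂ := H) (show m + m = n by omega)
    (hodgeClasses_tate_cast_eq_top m h)
  exact ⟨e.trans (LinearMap.ringLmapEquivSelf ℚ ℚ _), fun φ => by rw [LinearEquiv.trans_apply, LinearMap.ringLmapEquivSelf_apply, he]⟩

/-! ## §3 Into the Tate structure: `Hom_HS(V, ℚ(−m)) ≅ V₀` through a polarization -/

omit [Module.Finite ℚ V] in
/-- `(ψ(v,·))_ℂ(x) = ψ_ℂ(1 ⊗ v, x)` under `ℂ ⊗_ℚ ℚ = ℂ`. [cite: Deligne1982HodgeCycles, I §3 (proof of Prop. 3.6)] -/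
private theorem rid_baseChange_form_apply₉ (ψ : Polarization H) (v : V) (x : ℂ ⊗[ℚ] V) :
    TensorProduct.AlgebraTensorModule.rid ℚ ℂ ℂ ((ψ.form v).baseChange ℂ x) = ψ.form.baseChange ℂ (ofRat v) x := by
  induction x using TensorProduct.induction_on with
  | zero => simp only [map_zero]
  | add x y hx hy => simp only [map_add, hx, hy]
  | tmul c u =>
    rw [LinearMap.baseChange_tmul, TensorProduct.AlgebraTensorModule.rid_tmul, ofRat_apply, LinearMap.BilinForm.baseChange_tmul,
      one_mul]

omit [Module.Finite ℚ V] in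
/-- `(ψ(v,·))_ℂ(x) = 0 ⟺ ψ_ℂ(1 ⊗ v, x) = 0`. [cite: Deligne1982HodgeCycles, I §3 (proof of Prop. 3.6)] -/
private theorem baseChange_form_apply_eq_zero_iff₉ (ψ : Polarization H) (v : V) (x : ℂ ⊗[ℚ] V) :
    (ψ.form v).baseChange ℂ x = 0 ↔ ψ.form.baseChange ℂ (ofRat v) x = 0 := by
  rw [← rid_baseChange_form_apply₉ ψ v x, LinearEquiv.map_eq_zero_iff]

omit [Module.Finite ℚ V] in
/-- **For a Hodge vector `v ∈ V₀`, `ψ(v, ·) : V → ℚ(−m)` is a morphism of Hodge structures** (`ψ_ℂ(1 ⊗ v, F^{m+1}) = 0` by the first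
Hodge–Riemann relation, `1 ⊗ v ∈ Fᵐ`, `F^{m+1} = F^{n+1-m}`). [cite: Deligne1982HodgeCycles, I §3 (proof of Prop. 3.6)] [cite: DeligneHodgeII1971, 2.1.15] -/
theorem Polarization.exists_homToPure_toLinearMap_eq_form (ψ : Polarization H) {m : ℤ} (hn : n = 2 * m) {v : V}
    (hv : v ∈ H.hodgeClasses m) : ∃ φ : Hom H (pure ℚ m n hn), φ.toLinearMap = ψ.form v := by
  refine ⟨⟨ψ.form v, fun r => ?_⟩, rfl⟩
  rintro _ ⟨x, hx, rfl⟩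
  rcases le_or_gt r m with hr | hr
  · rw [pure_F, pureFiltration_of_le hr]
    exact Submodule.mem_top
  · have hx' : x ∈ H.F (n + 1 - m) := H.antitone_F (show n + 1 - m ≤ r by omega) hx
    have h0 : (ψ.form v).baseChange ℂ x = 0 :=
      (baseChange_form_apply_eq_zero_iff₉ ψ v x).2 (ψ.form_apply_eq_zero m (ofRat v) ((H.mem_hodgeClasses_iff m v).1 hv) x hx')
    rw [h0]
    exact Submodule.zero_mem _

omit [Module.Finite ℚ V] in
/-- **Conversely, if `ψ(v, ·)` underlies a morphism `V → ℚ(−m)` then `v ∈ V₀`**: `ψ_ℂ(1 ⊗ v, F^{m+1}) = 0` puts `1 ⊗ v` in the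
`ψ_ℂ`-orthogonal of `F^{n+1-m}`, which is `Fᵐ` (`Polarization.mem_F_iff`). [cite: Deligne1982HodgeCycles, I §3 (proof of Prop. 3.6)]
[cite: VoisinHodgeI2002, §7.1.2] -/
theorem Polarization.mem_hodgeClasses_of_homToPure_toLinearMap_eq_form (ψ : Polarization H) {m : ℤ} (hn : n = 2 * m) {v : V}
    (φ : Hom H (pure ℚ m n hn)) (hφ : φ.toLinearMap = ψ.form v) : v ∈ H.hodgeClasses m := by
  rw [mem_hodgeClasses_iff, ψ.mem_F_iff]
  intro x hx
  have h0 : ψ.form.baseChange ℂ (ofRat v) x = 0 := by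
    rw [← baseChange_form_apply_eq_zero_iff₉, ← hφ]
    have hmem := φ.map_F_le (n + 1 - m) ⟨x, hx, rfl⟩
    rwa [pure_F, pureFiltration_of_lt (show m < n + 1 - m by omega), Submodule.mem_bot] at hmem
  rw [ψ.form_baseChange_swap (ofRat v) x, h0, mul_zero]

omit [Module.Finite ℚ V] in
/-- `v ∈ V₀ ⟺ ψ(v, ·)` underlies a morphism `V → ℚ(−m)`. [cite: Deligne1982HodgeCycles, I §3 (proof of Prop. 3.6)] -/
theorem Polarization.mem_hodgeClasses_iff_exists_homToPure_eq_form (ψ : Polarization H) {m : ℤ} (hn : n = 2 * m) (v : V) :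
    v ∈ H.hodgeClasses m ↔ ∃ φ : Hom H (pure ℚ m n hn), φ.toLinearMap = ψ.form v :=
  ⟨fun hv => ψ.exists_homToPure_toLinearMap_eq_form hn hv, fun ⟨φ, hφ⟩ => ψ.mem_hodgeClasses_of_homToPure_toLinearMap_eq_form hn φ hφ⟩

omit [Module.Finite ℚ V] in
/-- `ψ(v, ·) = ψ(w, ·) ⟹ v = w` (non-degeneracy). [cite: VoisinHodgeI2002, §7.1.2] -/
theorem Polarization.eq_of_form_eq_form (ψ : Polarization H) {v w : V} (h : ψ.form v = ψ.form w) : v = w := by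
  rw [← sub_eq_zero]
  refine ψ.nondegenerate.1 _ fun y => ?_
  rw [map_sub, LinearMap.sub_apply, h, sub_self]

/-- **Every morphism `V → ℚ(−m)` is `ψ(v, ·)` for a (unique) Hodge vector `v ∈ V₀`** (`v = θ⁻¹ φ`, `θ = ψ♭ : V ≃ V^∨`).
[cite: Deligne1982HodgeCycles, I §3 (proof of Prop. 3.6)] [cite: DeligneHodgeII1971, 2.1.15] -/
theorem Polarization.exists_mem_hodgeClasses_homToPure_eq_form (ψ : Polarization H) {m : ℤ} (hn : n = 2 * m)
    (φ : Hom H (pure ℚ m n hn)) : ∃ v ∈ H.hodgeClasses m, φ.toLinearMap = ψ.form v := by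
  have hφ : φ.toLinearMap = ψ.form (ψ.toDualEquiv.symm φ.toLinearMap) := by
    refine LinearMap.ext fun w => ?_
    rw [← ψ.toDualEquiv_apply, LinearEquiv.apply_symm_apply]
  exact ⟨_, ψ.mem_hodgeClasses_of_homToPure_toLinearMap_eq_form hn φ hφ, hφ⟩

/-- **`Hom_HS(V, ℚ(−m)) ≅ V₀`**, `φ ↦` the Hodge vector `v` with `φ = ψ(v, ·)`. [cite: Deligne1982HodgeCycles, I §3 (proof of Prop. 3.6)]
[cite: Arapura2022, §1 p. 3] -/
theorem Polarization.exists_linearEquiv_homToPure_hodgeClasses (ψ : Polarization H) {m : ℤ} (hn : n = 2 * m) :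
    ∃ e : Hom H (pure ℚ m n hn) ≃ₗ[ℚ] H.hodgeClasses m, ∀ φ, ψ.form (e φ : V) = φ.toLinearMap := by
  have key : ∀ v : V, (ψ.toDualEquiv v : Module.Dual ℚ V) = ψ.form v := fun v => LinearMap.ext (ψ.toDualEquiv_apply v)
  have hmem : ∀ φ : Hom H (pure ℚ m n hn), ψ.toDualEquiv.symm φ.toLinearMap ∈ H.hodgeClasses m := fun φ =>
    ψ.mem_hodgeClasses_of_homToPure_toLinearMap_eq_form hn φ (by rw [← key, LinearEquiv.apply_symm_apply])
  have hlift : ∀ v : H.hodgeClasses m, ∃ φ : Hom H (pure ℚ m n hn), φ.toLinearMap = ψ.form (v : V) := fun v =>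
    ψ.exists_homToPure_toLinearMap_eq_form hn v.2
  choose lift hlift using hlift
  refine ⟨{ toFun := fun φ => ⟨ψ.toDualEquiv.symm φ.toLinearMap, hmem φ⟩
            map_add' := fun φ φ' => Subtype.ext (by simp [map_add])
            map_smul' := fun c φ => Subtype.ext (by simp [map_smul])
            invFun := lift
            left_inv := fun φ => Hom.ext ?_
            right_inv := fun v => Subtype.ext ?_ }, fun φ => ?_⟩
  · change (lift ⟨ψ.toDualEquiv.symm φ.toLinearMap, hmem φ⟩).toLinearMap = φ.toLinearMap
    rw [hlift, ← key, LinearEquiv.apply_symm_apply]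
  · change ψ.toDualEquiv.symm (lift v).toLinearMap = v
    rw [hlift, ← key, LinearEquiv.symm_apply_apply]
  · change ψ.form (ψ.toDualEquiv.symm φ.toLinearMap) = φ.toLinearMap
    rw [← key, LinearEquiv.apply_symm_apply]

/-- `dim_ℚ Hom_HS(V, ℚ(−m)) = dim V₀`. [cite: Deligne1982HodgeCycles, I §3 (proof of Prop. 3.6)] [cite: Arapura2022, §1 p. 3] -/
theorem Polarization.finrank_homToPure_eq_finrank_hodgeClasses (ψ : Polarization H) {m : ℤ} (hn : n = 2 * m) :
    finrank ℚ (Hom H (pure ℚ m n hn)) = finrank ℚ (H.hodgeClasses m) := by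
  obtain ⟨e, -⟩ := ψ.exists_linearEquiv_homToPure_hodgeClasses hn
  exact e.finrank_eq

/-- **`dim Hom_HS(V, ℚ(−m)) = dim Hom_HS(ℚ(−m), V)`** for a polarized `V` (self-duality `V ≅ V^∨(−n)` by `ψ`).
[cite: Deligne1982HodgeCycles, I §3 (proof of Prop. 3.6)] [cite: DeligneHodgeII1971, 2.1.15] -/
theorem Polarization.finrank_homToPure_eq_finrank_homFromPure (ψ : Polarization H) {m : ℤ} (hn : n = 2 * m) :
    finrank ℚ (Hom H (pure ℚ m n hn)) = finrank ℚ (Hom (pure ℚ m n hn) H) := by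
  rw [ψ.finrank_homToPure_eq_finrank_hodgeClasses hn, finrank_homFromPure_eq_finrank_hodgeClasses hn]

/-- `dim Hom_HS(V, ℚ(−m)) = dim Hom_HS(ℚ(−m), V)` for a polarizable `V`. [cite: DeligneHodgeII1971, 2.1.15] -/
theorem finrank_homToPure_eq_finrank_homFromPure_of_isPolarizable (hH : H.IsPolarizable) {m : ℤ} (hn : n = 2 * m) :
    finrank ℚ (Hom H (pure ℚ m n hn)) = finrank ℚ (Hom (pure ℚ m n hn) H) := by
  obtain ⟨ψ⟩ := hH
  exact ψ.finrank_homToPure_eq_finrank_homFromPure hn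

end HodgeStructure

end Literature.AlgebraicGeometry.Motives

end
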